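import Summits.ResolutionOfSingularities.ResolutionOfSingularities.Theorems.PurelyInseparableDim4HasseSingleLetter
import Summits.ResolutionOfSingularities.ResolutionOfSingularities.Theorems.PurelyInseparableDim4ResConePowerCone
import HarnessLib
import HarnessLib.Audit.Tags

/-!
# Purely inseparable four-folds — THE HASSE CONTACT POLYNOMIAL OF A POWER CONE: `D_c^{(d−1)} G` has linear part
# `a₀·d·ℓ_c^{d−1}·ℓ`, lies in `𝔪₀`, and is not in `(x_a, x_b)` when `ℓ_c ≠ 0` (glue for the slice-B (DL) assembly K11)

[OURS · counted 0 · cell `res-dim4-pi` · SLICE-B ARCHITECTURE OF RECORD `SLICE-B-ARCH-g3.md` v1.2 (K11 glue); seat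
res-dim4-p-12 g3.]  Nothing here proves K2(p), `NoIsolatedTrap p p` or resolution of singularities in dimension ≥ 4 /
characteristic `p`.  AI kernel work, weaker than expert review.

For a polynomial `G` whose monomials have degree `≥ d` and whose degree-`d` component is a POWER CONE
`a₀ · (Σ ℓᵢ xᵢ)^d` (slice B), and a letter `c`:
* `hasseDeriv_single_linearForm_pow` — `D_c^{(n)} (Σ ℓᵢ xᵢ)^m = C(m,n)·ℓ_c^n · (Σ ℓᵢ xᵢ)^{m−n}` (`n ≤ m`);
* `homogeneousComponent_hasseDeriv_single` — `D_c^{(n)}` maps the degree-`(m+n)` component onto the degree-`m`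
  component of the derivative; `coeff_hasseDeriv_single_eq_zero_of_lt` — below degree `d − n` the derivative vanishes;
* **`coeff_single_hasseDeriv_powerCone`** — `coeff_{e_e} (D_c^{(d−1)} G) = a₀ · d · ℓ_c^{d−1} · ℓ_e`;
* `hasseDeriv_single_mem_originIdeal` — `D_c^{(d−1)} G ∈ 𝔪₀` for `d ≥ 2`;
* `not_mem_span_X_pair_of_coeff_single_ne_zero` — a polynomial with a non-zero `x_e`-coefficient, `e ∉ {a, b}`, is not
  in `(x_a, x_b)`; hence **`hasseDeriv_powerCone_not_mem_span_X_pair`** (`ℓ_c ≠ 0`, `a₀ ≠ 0`, `d < p`, `c ∉ {a, b}`).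
bears_on: LADDER-RESOLUTION:D157-DOOR2 (res-dim4-pi · K2(p) slice B · K11 glue).  Supports
stmt-ResolutionOfSingularities-16155 (helper).
-/

set_option linter.dupNamespace false -- mandated namespace of this single-conjunct summit

noncomputable section

namespace Summit.ResolutionOfSingularities.ResolutionOfSingularities.Theorems.PIDim4

namespace IsolatedBand

open MvPolynomial Finset
open Literature.AlgebraicGeometry.Resolution

variable {K : Type} [Field K]

/-! ## 1. Single-letter Hasse derivatives of powers of a linear form -/

/-- `D_c^{(i)}` of a linear form: the form for `i = 0`, its `x_c`-coefficient for `i = 1`, zero beyond. [folklore] -/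
theorem hasseDeriv_single_linearForm (c : Fin 4) (ℓ : Fin 4 → K) (i : ℕ) :
    hasseDeriv (Finsupp.single c i) (∑ k, C (ℓ k) * X k : MvPolynomial (Fin 4) K) =
      if i = 0 then ∑ k, C (ℓ k) * X k else if i = 1 then C (ℓ c) else 0 := by
  classical
  rw [Equimultiple.hasseDeriv_eq, map_sum]
  simp_rw [show ∀ k, C (ℓ k) * (X k : MvPolynomial (Fin 4) K) = ℓ k • X k from fun k => by rw [smul_eq_C_mul],
    map_smul, Literature.AlgebraicGeometry.Resolution.hasseDeriv_X]
  by_cases h0 : i = 0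
  · subst h0
    rw [if_pos rfl, Finsupp.single_zero]
    refine Finset.sum_congr rfl fun k _ => ?_
    rw [if_pos rfl, if_neg (Ne.symm (Finsupp.single_ne_zero.mpr one_ne_zero)), add_zero]
  · rw [if_neg h0]
    have hne : (Finsupp.single c i : Fin 4 →₀ ℕ) ≠ 0 := Finsupp.single_ne_zero.mpr h0
    simp only [hne, if_false, zero_add]
    by_cases h1 : i = 1
    · subst h1
      rw [if_pos rfl, Finset.sum_eq_single c]
      · rw [if_pos rfl, smul_eq_C_mul, mul_one]
      · intro k _ hk
        rw [if_neg (fun h => hk (Finsupp.single_left_injective one_ne_zero h).symm), smul_zero]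
      · intro h; exact absurd (Finset.mem_univ c) h
    · rw [if_neg h1]
      refine Finset.sum_eq_zero fun k _ => ?_
      rw [if_neg, smul_zero]
      intro h
      have := congrArg (fun f : Fin 4 →₀ ℕ => f c) h
      simp only [Finsupp.single_eq_same] at this
      rw [Finsupp.single_apply] at this
      split_ifs at this <;> omega

/-- **`D_c^{(n)} L^m = C(m, n) · ℓ_c^n · L^{m−n}`** for a linear form `L = Σ ℓᵢ xᵢ` (all `m, n`; for `n > m` both
sides vanish).  Pascal induction on `m`. [folklore] -/
theorem hasseDeriv_single_linearForm_pow (c : Fin 4) (ℓ : Fin 4 → K) :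
    ∀ m n : ℕ, hasseDeriv (Finsupp.single c n) ((∑ k, C (ℓ k) * X k : MvPolynomial (Fin 4) K) ^ m) =
      C ((m.choose n : K) * ℓ c ^ n) * (∑ k, C (ℓ k) * X k) ^ (m - n) := by
  classical
  intro m
  induction m with
  | zero =>
    intro n
    rcases Nat.eq_zero_or_pos n with rfl | hn
    · rw [pow_zero, hasseDeriv_single_zero']
      simp
    · rw [pow_zero, Nat.choose_eq_zero_of_lt hn, Nat.cast_zero, zero_mul, C_0, zero_mul, ← C_1,
        Equimultiple.hasseDeriv_eq, Literature.AlgebraicGeometry.Resolution.hasseDeriv_C,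
        if_neg (Finsupp.single_ne_zero.mpr (by omega))]
  | succ m ih =>
    intro n
    rcases Nat.eq_zero_or_pos n with rfl | hnpos
    · rw [hasseDeriv_single_zero', Nat.choose_zero_right, Nat.cast_one, pow_zero, mul_one, C_1, one_mul, Nat.sub_zero]
    · obtain ⟨n', rfl⟩ : ∃ n', n = n' + 1 := ⟨n - 1, by omega⟩
      rw [pow_succ', hasseDeriv_single_mul, Finset.sum_range_succ', Finset.sum_range_succ']
      -- the terms with `D^{(i+2)} L` vanish
      have hzero : ∑ i ∈ Finset.range n',
          hasseDeriv (Finsupp.single c (i + 1 + 1)) (∑ k, C (ℓ k) * X k : MvPolynomial (Fin 4) K) *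
            hasseDeriv (Finsupp.single c (n' + 1 - (i + 1 + 1))) ((∑ k, C (ℓ k) * X k) ^ m) = 0 := by
        refine Finset.sum_eq_zero fun i _ => ?_
        rw [hasseDeriv_single_linearForm, if_neg (by omega), if_neg (by omega), zero_mul]
      rw [hzero, zero_add]
      simp only [zero_add, Nat.sub_zero, Nat.add_sub_cancel]
      rw [hasseDeriv_single_linearForm, if_neg one_ne_zero, if_pos rfl, hasseDeriv_single_linearForm, if_pos rfl,
        ih n', ih (n' + 1), Nat.choose_succ_succ, Nat.cast_add, show m + 1 - (n' + 1) = m - n' by omega]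
      by_cases hle : n' + 1 ≤ m
      · rw [show m - n' = m - (n' + 1) + 1 by omega, pow_succ']
        simp only [map_add, map_mul, map_pow, map_natCast]
        ring
      · push Not at hle
        rw [Nat.choose_eq_zero_of_lt hle]
        simp only [map_mul, map_pow, map_natCast, Nat.cast_zero, map_zero, add_zero]
        ring

/-! ## 2. The linear part of the Hasse contact polynomial of a power cone -/

/-- Coefficients of a single-letter Hasse derivative (the PIDim4 form of `coeff_hasseDeriv_single`). [folklore] -/
theorem coeff_hasseDeriv_single' (c : Fin 4) (n : ℕ) (F : MvPolynomial (Fin 4) K) (γ : Fin 4 →₀ ℕ) :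
    coeff γ (hasseDeriv (Finsupp.single c n) F) = ((γ c + n).choose n : K) * coeff (γ + Finsupp.single c n) F := by
  classical
  rw [Equimultiple.hasseDeriv_eq, Literature.AlgebraicGeometry.Resolution.coeff_hasseDeriv_single]

/-- **Below degree `d − n` the derivative of an order-`≥ d` polynomial vanishes.** [folklore] -/
theorem coeff_hasseDeriv_single_eq_zero_of_lt (c : Fin 4) (n : ℕ) {F : MvPolynomial (Fin 4) K} {d : ℕ}
    (hF : ∀ e ∈ F.support, d ≤ e.degree) {γ : Fin 4 →₀ ℕ} (hγ : γ.degree + n < d) :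
    coeff γ (hasseDeriv (Finsupp.single c n) F) = 0 := by
  rw [coeff_hasseDeriv_single', MvPolynomial.notMem_support_iff.mp, mul_zero]
  intro hmem
  have := hF _ hmem
  rw [map_add, Finsupp.degree_single] at this
  omega

/-- **In degree `d − n` the derivative only sees the degree-`d` component.** [folklore] -/
theorem coeff_hasseDeriv_single_eq_coeff_homogeneousComponent (c : Fin 4) (n : ℕ) (F : MvPolynomial (Fin 4) K)
    {d : ℕ} {γ : Fin 4 →₀ ℕ} (hγ : γ.degree + n = d) :
    coeff γ (hasseDeriv (Finsupp.single c n) F) =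
      coeff γ (hasseDeriv (Finsupp.single c n) (homogeneousComponent d F)) := by
  rw [coeff_hasseDeriv_single', coeff_hasseDeriv_single', coeff_homogeneousComponent, if_pos]
  rw [map_add, Finsupp.degree_single, hγ]

/-- **THE LINEAR PART OF THE HASSE CONTACT POLYNOMIAL OF A POWER CONE**: if the monomials of `G` have degree `≥ d`
and its degree-`d` component is `a₀ · L^d`, `L = Σ ℓᵢ xᵢ`, `1 ≤ d`, then
`coeff_{e_e} (D_c^{(d−1)} G) = a₀ · d · ℓ_c^{d−1} · ℓ_e`. [OURS] -/
theorem coeff_single_hasseDeriv_powerCone (c e : Fin 4) {G : MvPolynomial (Fin 4) K} {d : ℕ} (hd : 1 ≤ d)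
    {a₀ : K} {ℓ : Fin 4 → K} (hg : homogeneousComponent d G = C a₀ * (∑ k, C (ℓ k) * X k) ^ d) :
    coeff (Finsupp.single e 1) (hasseDeriv (Finsupp.single c (d - 1)) G) = a₀ * d * ℓ c ^ (d - 1) * ℓ e := by
  classical
  rw [coeff_hasseDeriv_single_eq_coeff_homogeneousComponent c (d - 1) G (d := d)
    (by rw [Finsupp.degree_single]; omega), hg, Equimultiple.hasseDeriv_eq,
    show C a₀ * (∑ k, C (ℓ k) * X k : MvPolynomial (Fin 4) K) ^ d = a₀ • (∑ k, C (ℓ k) * X k) ^ d by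
      rw [smul_eq_C_mul], map_smul, ← Equimultiple.hasseDeriv_eq, hasseDeriv_single_linearForm_pow,
    show d - (d - 1) = 1 by omega, pow_one, smul_eq_C_mul, ← mul_assoc, ← C_mul, coeff_C_mul, coeff_sum,
    Finset.sum_eq_single e]
  · rw [coeff_C_mul, coeff_X, if_pos rfl, mul_one, show d.choose (d - 1) = d from by
      rw [show d.choose (d - 1) = d.choose (d - (d - 1)) from (Nat.choose_symm (by omega)).symm,
        show d - (d - 1) = 1 by omega, Nat.choose_one_right]]
    ring
  · intro k _ hk
    rw [coeff_C_mul, coeff_X, if_neg (fun h => hk (Finsupp.single_left_injective one_ne_zero h)), mul_zero]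
  · intro h; exact absurd (Finset.mem_univ e) h

/-- **The Hasse contact polynomial vanishes at the origin** (`d ≥ 2`, monomials of `G` of degree `≥ d`). [folklore] -/
theorem hasseDeriv_single_mem_originIdeal (c : Fin 4) {G : MvPolynomial (Fin 4) K} {d : ℕ} (hd : 2 ≤ d)
    (hG : ∀ e ∈ G.support, d ≤ e.degree) : hasseDeriv (Finsupp.single c (d - 1)) G ∈ originIdeal K := by
  unfold originIdeal
  rw [RingHom.mem_ker, MvPolynomial.eval_zero, constantCoeff_eq]
  exact coeff_hasseDeriv_single_eq_zero_of_lt c (d - 1) hG (by rw [map_zero]; omega)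

/-- A polynomial with a non-zero `x_e`-coefficient (`e ∉ {a, b}`) is not in `(x_a, x_b)`. [folklore] -/
theorem not_mem_span_X_pair_of_coeff_single_ne_zero {a b e : Fin 4} (hea : e ≠ a) (heb : e ≠ b)
    {P : MvPolynomial (Fin 4) K} (h : coeff (Finsupp.single e 1) P ≠ 0) :
    P ∉ Ideal.span {(X a : MvPolynomial (Fin 4) K), X b} := by
  intro hP
  obtain ⟨S, T, hST⟩ := Ideal.mem_span_pair.mp hP
  apply h
  rw [← hST, coeff_add, coeff_mul_X', coeff_mul_X', if_neg, if_neg, add_zero]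
  · rw [Finsupp.mem_support_iff, Finsupp.single_eq_of_ne heb.symm]; exact fun h => h rfl
  · rw [Finsupp.mem_support_iff, Finsupp.single_eq_of_ne hea.symm]; exact fun h => h rfl

/-- **The Hasse contact polynomial of a power cone is not in `(x_a, x_b)`** when its letter carries the form
(`ℓ_c ≠ 0`, `c ∉ {a, b}`, `a₀ ≠ 0`, `1 ≤ d < p` in characteristic `p`). [OURS] -/
theorem hasseDeriv_powerCone_not_mem_span_X_pair (p : ℕ) [Fact p.Prime] [CharP K p] {a b c : Fin 4}
    (hca : c ≠ a) (hcb : c ≠ b) {G : MvPolynomial (Fin 4) K} {d : ℕ} (hd : 1 ≤ d) (hdp : d < p) {a₀ : K}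
    (ha₀ : a₀ ≠ 0) {ℓ : Fin 4 → K} (hℓc : ℓ c ≠ 0)
    (hg : homogeneousComponent d G = C a₀ * (∑ k, C (ℓ k) * X k) ^ d) :
    hasseDeriv (Finsupp.single c (d - 1)) G ∉ Ideal.span {(X a : MvPolynomial (Fin 4) K), X b} := by
  refine not_mem_span_X_pair_of_coeff_single_ne_zero hca hcb ?_
  rw [coeff_single_hasseDeriv_powerCone c c hd hg, mul_assoc, ← pow_succ, show d - 1 + 1 = d by omega]
  exact mul_ne_zero (mul_ne_zero ha₀ (ResCone.natCast_ne_zero_of_lt p hd hdp)) (pow_ne_zero _ hℓc)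

/-- **The first-order Hasse coefficient in the letter `c`**: `(D_c^{(1)} h)(0) = coeff_{e_c} h`. [folklore] -/
theorem eval_hasseDeriv_single_one (c : Fin 4) (h : MvPolynomial (Fin 4) K) :
    MvPolynomial.eval (0 : Fin 4 → K) (hasseDeriv (Finsupp.single c 1) h) = coeff (Finsupp.single c 1) h := by
  rw [MvPolynomial.eval_zero, Equimultiple.hasseDeriv_eq, Literature.AlgebraicGeometry.Resolution.constantCoeff_hasseDeriv]

end IsolatedBand

end Summit.ResolutionOfSingularities.ResolutionOfSingularities.Theorems.PIDim4

end
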